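import Summits.MatrixMultiplication.OmegaCensus.STPPSmallPatternKernelSearch
import Mathlib.Data.Finset.Card
import Mathlib.Data.Nat.Find
import Mathlib.Data.ZMod.Basic
import Summits.MatrixMultiplication.OmegaCensus.STPP222IcosetWSearchTriples

/-!
# ω-census, small STPP pattern `(2,1,1)^k`: kernel search — bit lemmas, encodings, mask semantics, `ℤ/n`

HONEST FRAMING (pub-omega census; verbatim): lottery ticket; floor = certified bounds/negative ranges.
Census STRUCTURE bookkeeping of the STPP track (seat pub-omega-stpp-3, gen 23; STRUCTURE row B5, the threshold column
`T1(H) = max {k : (2,1,1)^k ⊆ H}` — its LOWER sides as kernel theorems), not progress on `ω`: small patterns in small groups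
bound no exponent.

First of three reflection files for the engine `STPPSmallPatternKernelSearch.lean` (soundness of `STPP211Neg.search`):
* §1 bit lemmas: clearing the lowest set bit (`G &&& (G − 1)`), the loop `allBits` visits every set bit, the room test
  `hasBits r F` passes on any `F` with `r` set bits (witnessed by a finset of positions);
* §2 `GEnc`: an encoding of an abelian group matching a code arithmetic `GC` (injective numbering, `sub`/`neg`, and the
  one-sided translation property «every set code bit of `tr M t` comes from a set code bit of `M` shifted by `t`»), and the
  one-sided MASK SEMANTICS `MSub E M P` («`M < 2^n` and every element whose code bit is set satisfies `P`») with its algebra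
  (`0`, single bit, union, translate);
* §3 the encoding `zmodEnc n` of `ℤ/n` by `ZMod.val` with ROTATION as translation (`testBit_rot`).
Nothing is trusted: `decide +kernel` evaluations of `search` become theorems only through these lemmas and the two sequel
files (`…KernelInvariant.lean`, `…KernelReflect.lean`).

References: H. Cohn, R. Kleinberg, B. Szegedy, C. Umans, *Group-theoretic algorithms for matrix multiplication*, FOCS 2005
(arXiv:math/0511460), Def. 5.1.  Record: pub-omega HOME `pub-omega-stpp-3-g23/` (engine mirror `k211v3.py`, counts, kernel timings).
-/

namespace Summit.MatrixMultiplication.OmegaCensus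

namespace STPP211Neg



/-! ## 1. Bit lemmas -/

/-- `Nat.land` is `&&&`. -/ theorem land_eq (a b : ℕ) : Nat.land a b = a &&& b := rfl
/-- `Nat.lor` is `|||`. -/ theorem lor_eq (a b : ℕ) : Nat.lor a b = a ||| b := rfl
/-- `Nat.xor` is `^^^`. -/ theorem xor_eq (a b : ℕ) : Nat.xor a b = a ^^^ b := rfl
/-- `Nat.shiftLeft` is `<<<`. -/ theorem shiftLeft_eq' (a b : ℕ) : Nat.shiftLeft a b = a <<< b := rfl
/-- `Nat.shiftRight` is `>>>`. -/ theorem shiftRight_eq' (a b : ℕ) : Nat.shiftRight a b = a >>> b := rfl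
/-- `Nat.sub` is `-`. -/ theorem sub_eq' (a b : ℕ) : Nat.sub a b = a - b := rfl
/-- `Nat.add` is `+`. -/ theorem add_eq' (a b : ℕ) : Nat.add a b = a + b := rfl
/-- `Nat.mul` is `*`. -/ theorem mul_eq' (a b : ℕ) : Nat.mul a b = a * b := rfl
/-- `Nat.mod` is `%`. -/ theorem mod_eq' (a b : ℕ) : Nat.mod a b = a % b := rfl


/-- **Clearing the lowest set bit.** For `G ≠ 0` there is a set bit `i` of `G` such that `G &&& (G − 1)` has exactly
the set bits of `G` other than `i`. [folklore] -/
theorem testBit_land_pred {G : ℕ} (hG : G ≠ 0) :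
    ∃ i, G.testBit i = true ∧ ∀ x, (G &&& (G - 1)).testBit x = (G.testBit x && !(x == i)) := by
  classical
  have hex : ∃ i, G.testBit i = true := by
    obtain ⟨i, hi, -⟩ := Nat.exists_most_significant_bit hG
    exact ⟨i, hi⟩
  let i := Nat.find hex
  have hi : G.testBit i = true := Nat.find_spec hex
  have hlow : ∀ j < i, G.testBit j = false := fun j hj => by
    have := Nat.find_min hex hj
    simpa using this
  -- decomposition G = 2^(i+1) * A + 2^i with A = G >>> (i+1)
  set A := G >>> (i + 1) with hA
  have hdec : G = 2 ^ (i + 1) * A + 2 ^ i := by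
    apply Nat.eq_of_testBit_eq
    intro j
    rw [Nat.testBit_two_pow_mul_add A (Nat.pow_lt_pow_right Nat.one_lt_two (Nat.lt_succ_self i)) j]
    by_cases hj : j < i + 1
    · rw [if_pos hj, Nat.testBit_two_pow]
      rcases Nat.lt_succ_iff_lt_or_eq.1 hj with hj' | rfl
      · rw [hlow j hj']; simp; omega
      · rw [hi]; simp
    · rw [if_neg hj, hA, Nat.testBit_shiftRight]
      congr 1; omega
  have hdec' : G - 1 = 2 ^ (i + 1) * A + (2 ^ i - 1) := by
    have h1 : 1 ≤ 2 ^ i := Nat.one_le_two_pow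
    omega
  refine ⟨i, hi, fun x => ?_⟩
  have hb : 2 ^ i - 1 < 2 ^ (i + 1) :=
    lt_of_lt_of_le (Nat.sub_lt Nat.one_le_two_pow Nat.one_pos) (Nat.pow_le_pow_right Nat.two_pos (Nat.le_succ i))
  rw [Nat.testBit_land]
  conv_lhs => rw [hdec', Nat.testBit_two_pow_mul_add A hb x]
  by_cases hx : x < i + 1
  · rw [if_pos hx, Nat.testBit_two_pow_sub_one]
    rcases Nat.lt_succ_iff_lt_or_eq.1 hx with hx' | rfl
    · rw [hlow x hx']; simp
    · rw [hi]; simp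
  · rw [if_neg hx]
    have hxi : (x == i) = false := by simp; omega
    have hGx : G.testBit x = A.testBit (x - (i + 1)) := by
      conv_lhs => rw [hdec, Nat.testBit_two_pow_mul_add A (Nat.pow_lt_pow_right Nat.one_lt_two (Nat.lt_succ_self i)) x,
        if_neg hx]
    rw [hxi, hGx]; simp

/-- `lowBit G = 2 ^ i` and the remainder `G ^^^ lowBit G = G &&& (G − 1)`, for the `i` of `testBit_land_pred`. -/
theorem lowBit_spec {G : ℕ} (hG : G ≠ 0) :
    ∃ i, G.testBit i = true ∧ lowBit G = 2 ^ i ∧ Nat.xor G (lowBit G) = Nat.land G (G - 1) ∧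
      ∀ x, (Nat.land G (G - 1)).testBit x = (G.testBit x && !(x == i)) := by
  obtain ⟨i, hi, hbits⟩ := testBit_land_pred hG
  have hL : lowBit G = 2 ^ i := by
    apply Nat.eq_of_testBit_eq
    intro j
    show (G ^^^ (G &&& (G - 1))).testBit j = _
    rw [Nat.testBit_xor, hbits j, Nat.testBit_two_pow]
    by_cases hj : j = i
    · subst hj; rw [hi]; simp
    · have : (j == i) = false := by simp [hj]
      rw [this]
      have : decide (i = j) = false := by simp; exact fun h => hj h.symm
      rw [this]
      cases G.testBit j <;> simp
  refine ⟨i, hi, hL, ?_, hbits⟩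
  apply Nat.eq_of_testBit_eq
  intro j
  show (G ^^^ lowBit G).testBit j = (G &&& (G - 1)).testBit j
  rw [hL, Nat.testBit_xor, Nat.testBit_two_pow, hbits j]
  by_cases hj : j = i
  · subst hj; rw [hi]; simp
  · have h1 : (j == i) = false := by simp [hj]
    have h2 : decide (i = j) = false := by simp; exact fun h => hj h.symm
    rw [h1, h2]; cases G.testBit j <;> simp

/-- **`allBits` visits every set bit**: if `F ≤ fuel` and the conjunction over the set bits of `F` holds, then `body x`
holds for every set bit `x` of `F`. -/
theorem allBits_spec (body : ℕ → Bool) : ∀ (fuel F : ℕ), F ≤ fuel → allBits fuel body F = true →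
    ∀ x, F.testBit x = true → body x = true := by
  intro fuel
  induction fuel with
  | zero =>
      intro F hF _ x hx
      have : F = 0 := Nat.le_zero.1 hF
      subst this; simp at hx
  | succ fuel ih =>
      intro F hF h x hx
      have hF0 : F ≠ 0 := by rintro rfl; simp at hx
      have hbeq : Nat.beq F 0 = false := IcosetW.beq_false_of_ne hF0
      have h' : (force (lowBit F) fun L => body (Nat.log2 L) && allBits fuel body (Nat.xor F L)) = true := by
        have := h
        simp only [allBits] at this ⊢
        rw [hbeq] at this
        exact this
      rw [force_eq, Bool.and_eq_true] at h'
      obtain ⟨i, hi, hL, hrem, hbits⟩ := lowBit_spec hF0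
      rw [hL, Nat.log2_two_pow] at h'
      by_cases hxi : x = i
      · subst hxi; exact h'.1
      · have hrem' : Nat.xor F (2 ^ i) = Nat.land F (F - 1) := by rw [← hL]; exact hrem
        rw [hrem'] at h'
        refine ih (Nat.land F (F - 1)) ?_ h'.2 x ?_
        · have : F &&& (F - 1) ≤ F - 1 := Nat.and_le_right
          show F &&& (F - 1) ≤ fuel
          omega
        · rw [hbits x, hx]; simp [hxi]

/-- `dropBits` unfolds. -/
theorem dropBits_succ (r F : ℕ) : dropBits (r + 1) F = Nat.land (dropBits r F) (dropBits r F - 1) := by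
  show force (dropBits r F) (fun G => Nat.land G (Nat.sub G 1)) = _
  rw [force_eq]; rfl

/-- **`hasBits` is complete**: a number with at least `r` set bits (witnessed by a finset of positions) passes. -/
theorem hasBits_of_card (F : ℕ) : ∀ (r : ℕ) (S : Finset ℕ), (∀ x ∈ S, F.testBit x = true) → r ≤ S.card →
    hasBits r F = true := by
  -- invariant on dropBits
  have key : ∀ s : ℕ, ∀ S : Finset ℕ, (∀ x ∈ S, F.testBit x = true) →
      ∃ T : Finset ℕ, S.card ≤ T.card + s ∧ ∀ x ∈ T, (dropBits s F).testBit x = true := by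
    intro s
    induction s with
    | zero => intro S hS; exact ⟨S, by simp, hS⟩
    | succ s ih =>
        intro S hS
        obtain ⟨T, hcard, hT⟩ := ih S hS
        by_cases hG : dropBits s F = 0
        · -- then T is empty
          have hT0 : T = ∅ := by
            rw [Finset.eq_empty_iff_forall_notMem]
            intro x hx
            have := hT x hx
            rw [hG] at this; simp at this
          refine ⟨∅, ?_, by simp⟩
          rw [hT0] at hcard; simp at hcard ⊢; omega
        · obtain ⟨i, -, hbits⟩ := testBit_land_pred hG
          refine ⟨T.erase i, ?_, fun x hx => ?_⟩
          · by_cases hiT : i ∈ T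
            · have := Finset.card_erase_add_one hiT
              omega
            · rw [Finset.erase_eq_of_notMem hiT]; omega
          · rw [dropBits_succ, land_eq, hbits x, hT x (Finset.mem_of_mem_erase hx)]
            simp [Finset.ne_of_mem_erase hx]
  intro r S hS hr
  cases r with
  | zero => rfl
  | succ r =>
      show (!(Nat.beq (dropBits r F) 0)) = true
      obtain ⟨T, hcard, hT⟩ := key r S hS
      have hTne : T.Nonempty := by
        rw [← Finset.card_pos]; omega
      obtain ⟨x, hx⟩ := hTne
      have hne : dropBits r F ≠ 0 := by
        intro h0; have := hT x hx; rw [h0] at this; simp at this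
      rw [IcosetW.beq_false_of_ne hne]; rfl

/-- A number with a set bit is nonzero, read on `Nat.beq`. -/
theorem beq_zero_eq_false_of_testBit {F x : ℕ} (h : F.testBit x = true) : Nat.beq F 0 = false := by
  have : F ≠ 0 := by rintro rfl; simp at h
  exact IcosetW.beq_false_of_ne this

/-! ## 2. Encodings and mask semantics -/

/-- An ENCODING of the abelian group `G` matching a code arithmetic `g : GC`: an injective numbering `enc` of the elements by
codes `< g.n` (with `enc 0 = 0`), intertwining `sub`/`neg`, and a translation `tr` every set CODE bit of whose output comes
from a set code bit of the input shifted by the translating element (only this direction is needed for a refutation). -/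
structure GEnc (G : Type) [AddCommGroup G] where
  /-- the code arithmetic -/ g : GC
  /-- the numbering -/ enc : G → ℕ
  /-- codes are `< n` -/ enc_lt : ∀ x, enc x < g.n
  /-- the numbering is injective -/ enc_inj : Function.Injective enc
  /-- `0` has code `0` -/ enc_zero : enc 0 = 0
  /-- the all-codes mask -/ full_eq : g.full = 2 ^ g.n - 1
  /-- `sub` is subtraction -/ sub_enc : ∀ x y, g.sub (enc x) (enc y) = enc (x - y)
  /-- `neg` is negation -/ neg_enc : ∀ x, g.neg (enc x) = enc (-x)
  /-- translates are masks -/ tr_lt : ∀ M t, g.tr M t < 2 ^ g.n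
  /-- set code bits of a translate come from set code bits -/
  tr_spec : ∀ (M : ℕ) (t z : G), M < 2 ^ g.n → (g.tr M (enc t)).testBit (enc z) = true →
    ∃ x, M.testBit (enc x) = true ∧ z = x + t

variable {G : Type} [AddCommGroup G] (E : GEnc G)

/-- MASK SEMANTICS (one-sided): `M` is a mask (`< 2^n`) and every element whose code bit is set in `M` satisfies `P`. -/
def MSub (M : ℕ) (P : G → Prop) : Prop := M < 2 ^ E.g.n ∧ ∀ x, M.testBit (E.enc x) = true → P x

variable {E}

/-- Weakening the predicate. -/
theorem MSub.mono {M : ℕ} {P Q : G → Prop} (h : MSub E M P) (hPQ : ∀ x, P x → Q x) : MSub E M Q :=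
  ⟨h.1, fun x hx => hPQ x (h.2 x hx)⟩

/-- An element failing the predicate has a clear bit. -/
theorem MSub.testBit_eq_false {M : ℕ} {P : G → Prop} (h : MSub E M P) {x : G} (hx : ¬ P x) :
    M.testBit (E.enc x) = false := by
  cases hb : M.testBit (E.enc x)
  · rfl
  · exact absurd (h.2 x hb) hx

variable (E)

/-- The empty mask. -/
theorem MSub_zero (P : G → Prop) : MSub E 0 P :=
  ⟨Nat.two_pow_pos _, fun x hx => by simp at hx⟩

/-- A single bit. -/
theorem MSub_bit {x : G} {P : G → Prop} (hx : P x) : MSub E (bit (E.enc x)) P := by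
  refine ⟨?_, fun y hy => ?_⟩
  · show Nat.shiftLeft 1 (E.enc x) < _
    rw [shiftLeft_eq', Nat.one_shiftLeft]
    exact Nat.pow_lt_pow_right Nat.one_lt_two (E.enc_lt x)
  · have hy' : (2 ^ E.enc x).testBit (E.enc y) = true := by
      have : bit (E.enc x) = 2 ^ E.enc x := by
        show Nat.shiftLeft 1 (E.enc x) = _; rw [shiftLeft_eq', Nat.one_shiftLeft]
      rw [← this]; exact hy
    rw [Nat.testBit_two_pow] at hy'
    have := E.enc_inj (of_decide_eq_true hy').symm
    rw [this]; exact hx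

/-- Union. -/
theorem MSub_lor {M N : ℕ} {P : G → Prop} (hM : MSub E M P) (hN : MSub E N P) : MSub E (Nat.lor M N) P := by
  refine ⟨?_, fun y hy => ?_⟩
  · rw [lor_eq]; exact Nat.or_lt_two_pow hM.1 hN.1
  · rw [lor_eq, Nat.testBit_lor, Bool.or_eq_true] at hy
    rcases hy with hy | hy
    · exact hM.2 y hy
    · exact hN.2 y hy

/-- Union with different predicates. -/
theorem MSub_lor' {M N : ℕ} {P Q R : G → Prop} (hM : MSub E M P) (hN : MSub E N Q) (hP : ∀ x, P x → R x)
    (hQ : ∀ x, Q x → R x) : MSub E (Nat.lor M N) R :=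
  MSub_lor E (hM.mono hP) (hN.mono hQ)

/-- Translation by an element. -/
theorem MSub_tr {M : ℕ} {P : G → Prop} (hM : MSub E M P) (t : G) :
    MSub E (E.g.tr M (E.enc t)) (fun z => ∃ x, P x ∧ z = x + t) := by
  refine ⟨E.tr_lt _ _, fun z hz => ?_⟩
  obtain ⟨x, hx, rfl⟩ := E.tr_spec M t z hM.1 hz
  exact ⟨x, hM.2 x hx, rfl⟩

/-- The all-codes mask has every code bit set. -/
theorem testBit_full (x : G) : E.g.full.testBit (E.enc x) = true := by
  rw [E.full_eq, Nat.testBit_two_pow_sub_one]; simpa using E.enc_lt x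

/-- A code bit of `full ^^^ M` is set iff it is clear in `M`. -/
theorem testBit_full_xor {M : ℕ} (x : G) (h : M.testBit (E.enc x) = false) :
    (Nat.xor E.g.full M).testBit (E.enc x) = true := by
  rw [xor_eq, Nat.testBit_xor, testBit_full, h]; rfl

/-- A code bit of `lowMask k &&& full`: set iff the code is `< k`. -/
theorem testBit_lowMask_land (k : ℕ) (x : G) :
    (Nat.land (lowMask k) E.g.full).testBit (E.enc x) = decide (E.enc x < k) := by
  rw [land_eq, Nat.testBit_land, testBit_full, Bool.and_true]
  show (Nat.sub (Nat.shiftLeft 1 k) 1).testBit _ = _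
  rw [shiftLeft_eq', Nat.one_shiftLeft]
  exact Nat.testBit_two_pow_sub_one k _

/-- Masks built by the engine stay below `2 ^ n`: `lowMask k &&& full`. -/
theorem lowMask_land_lt (k : ℕ) : Nat.land (lowMask k) E.g.full < 2 ^ E.g.n := by
  rw [land_eq, E.full_eq]; exact Nat.and_lt_two_pow _ (Nat.sub_lt (Nat.two_pow_pos _) Nat.one_pos)

/-! ## 3. The encoding of `ℤ/n` -/

/-- Bits of a rotation: bit `y < n` of `rot n (2^n − 1) M t` (`M < 2^n`, `t ≤ n`) is bit `y − t` of `M` if `t ≤ y`, and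
bit `y + (n − t)` of `M` otherwise. -/
theorem testBit_rot {n M t y : ℕ} (hM : M < 2 ^ n) (ht : t ≤ n) (hy : y < n) :
    (rot n (lowMask n) M t).testBit y = if t ≤ y then M.testBit (y - t) else M.testBit (y + (n - t)) := by
  unfold rot
  rw [land_eq, lor_eq, shiftLeft_eq', shiftRight_eq', Nat.testBit_land, Nat.testBit_lor, Nat.testBit_shiftLeft,
    Nat.testBit_shiftRight]
  have hfull : (lowMask n).testBit y = true := by
    show (Nat.sub (Nat.shiftLeft 1 n) 1).testBit y = true
    rw [shiftLeft_eq', sub_eq', Nat.one_shiftLeft, Nat.testBit_two_pow_sub_one]; simpa using hy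
  rw [hfull, Bool.and_true, sub_eq']
  by_cases hty : t ≤ y
  · rw [if_pos hty]
    have h2 : M.testBit (n - t + y) = false :=
      Nat.testBit_lt_two_pow (lt_of_lt_of_le hM (Nat.pow_le_pow_right Nat.two_pos (by omega)))
    rw [h2, Bool.or_false]
    simp [hty]
  · rw [if_neg hty]
    have h1 : decide (y ≥ t) = false := by simp; omega
    rw [h1, Bool.false_and, Bool.false_or]
    congr 1; omega

/-- THE ENCODING OF `ℤ/n` by `ZMod.val`, with rotation as translation. -/
noncomputable def zmodEnc (n : ℕ) [NeZero n] : GEnc (ZMod n) where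
  g := zcode n
  enc := ZMod.val
  enc_lt := ZMod.val_lt
  enc_inj := ZMod.val_injective n
  enc_zero := ZMod.val_zero
  full_eq := by
    show Nat.sub (Nat.shiftLeft 1 n) 1 = 2 ^ n - 1
    rw [shiftLeft_eq', sub_eq', Nat.one_shiftLeft]
  sub_enc x y := by
    show (x.val + (n - y.val)) % n = (x - y).val
    rw [sub_eq_add_neg, ZMod.val_add, ZMod.neg_val]
    split_ifs with h
    · rw [h, ZMod.val_zero, Nat.sub_zero, Nat.add_zero, Nat.add_mod_right, Nat.mod_eq_of_lt (ZMod.val_lt x)]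
    · rfl
  neg_enc x := by
    show (n - x.val) % n = (-x).val
    rw [ZMod.neg_val]
    split_ifs with h
    · rw [h, ZMod.val_zero, Nat.sub_zero, Nat.mod_self]
    · have hx : 0 < x.val := Nat.pos_of_ne_zero fun h0 => h ((ZMod.val_eq_zero x).1 h0)
      exact Nat.mod_eq_of_lt (Nat.sub_lt (NeZero.pos n) hx)
  tr_lt M t := by
    show Nat.land _ (lowMask n) < 2 ^ n
    rw [land_eq]
    refine Nat.and_lt_two_pow _ ?_
    show Nat.sub (Nat.shiftLeft 1 n) 1 < 2 ^ n
    rw [shiftLeft_eq', sub_eq', Nat.one_shiftLeft]; exact Nat.sub_lt (Nat.two_pow_pos _) Nat.one_pos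
  tr_spec M t z hM hz := by
    have hM' : M < 2 ^ n := hM
    have ht : t.val ≤ n := le_of_lt (ZMod.val_lt t)
    have hz' : (rot n (lowMask n) M t.val).testBit z.val = true := hz
    rw [testBit_rot hM' ht (ZMod.val_lt z)] at hz'
    -- the source index
    set s : ℕ := if t.val ≤ z.val then z.val - t.val else z.val + (n - t.val) with hs
    have hsrc : M.testBit s = true := by
      rw [hs]; split_ifs with h <;> simp_all
    have hslt : s < n := by
      rw [hs]; split_ifs with h
      · exact lt_of_le_of_lt (Nat.sub_le _ _) (ZMod.val_lt z)
      · have := ZMod.val_lt z; have := ZMod.val_lt t; omega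
    refine ⟨(s : ZMod n), ?_, ?_⟩
    · rw [ZMod.val_cast_of_lt hslt]; exact hsrc
    · apply ZMod.val_injective n
      rw [ZMod.val_add, ZMod.val_cast_of_lt hslt, hs]
      split_ifs with h
      · rw [Nat.sub_add_cancel h, Nat.mod_eq_of_lt (ZMod.val_lt z)]
      · have hzl := ZMod.val_lt z
        rw [show z.val + (n - t.val) + t.val = z.val + n by omega, Nat.add_mod_right, Nat.mod_eq_of_lt hzl]

end STPP211Neg

end Summit.MatrixMultiplication.OmegaCensus
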